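import Mathlib.FieldTheory.Minpoly.IsConjRoot
import Mathlib.FieldTheory.IsAlgClosed.Basic
import Mathlib.FieldTheory.IntermediateField.Adjoin.Basic
import Mathlib.RingTheory.Coprime.Lemmas
import Mathlib.RingTheory.PrincipalIdealDomain
import HarnessLib

/-!
# [GenEll] Thm. 2.1 (ii) ⇒ (i) for `ℙ¹`: per-configuration protection on `D_e` — the pole set
# `T` of `ψ_T` and EXACT AVOIDANCE (`havoid` producer for the persistent spine)

S. Mochizuki, *Arithmetic elliptic curves in general position*, Math. J. Okayama Univ. 52 (2010)
[cite: MochizukiGenEll2010, Thm 2.1 p.12], proof of Thm. 2.1, p. 12: for each (limit) configuration of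
conjugates a noncritical Belyi map is chosen which is "noncritical at" — protects — the points of the
configuration. In the number-field route to `GenEllTwo` (abc-iut cell, GENELLTWO-P1ROUTE v2, owner
abc-iut-S6, RULING #6 + amendment, 2026-08-26): on the curve `D_e : r^e = x(1−x)`, `e = 2k+1`, with the
function `t_c = ((1−2x) + c·r^{k+2})/(r(1−2x))` (`c ∈ ℚ^×`), a configuration with algebraic entries the
roots of `q ∈ ℚ[X]` is protected by `φ_T := β_T ∘ ψ_T ∘ t_c`, `ψ_T(u) := u + c_T′(u)/c_T(u)`, where
`c_T ∈ ℚ[X]` cuts out the POLE SET `T :=` the `t_c`-values of the curve points over the entries: these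
points go to `ψ_T = ∞`, which `β_T` protects. This file supplies the ALGEBRA of that step (no `β`, no
analysis; W6⁺/W5/W7 consume it by name):

* `exists_polePoly` — for `q ≠ 0` there is `c_T ∈ ℚ[X]`, `c_T ≠ 0`, whose roots in an algebraic closure
  `L` of `ℚ` are EXACTLY the values `t_c(z)` at the non-polar curve points `z ∈ D_e(L)` over the roots of
  `q` (so `T` is finite and Galois-stable for free);
* `polePoly_root_not_mem` — if `q` is coprime to the persistent polynomial `Pers` of `t_c` (whose roots
  contain the `x`-coordinate of every point whose `t_c`-value is critical — abstract hypothesis `hCV`),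
  then NO root of `c_T` is a critical value: `ψ_T` is admissible for the Belyi composition
  (`β_T ∘ ψ_T ∘ t_c` is Belyi iff `T ∩ critvals(t_c) = ∅`);
* `aeval_eq_zero_of_point` — the vanishing `c_T(t_c(w)) = 0` transported to the points `w` of
  `D_e` over the roots of `q` in ANY field (`ℂ`, `Q̄₂`), via an embedding of `ℚ(w)` into `L`;
  packaged with `exists_polePoly` as `exists_polePoly_anyField`;
* `exists_badPoly_isCoprime` — EXACT AVOIDANCE: if the bad `u`-values `B″` of the mechanism (the
  finite values of `ψ_T⁻¹(β_T⁻¹{0,1,∞})`) avoid the `t_c`-values over the entries (they do: those are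
  poles of `ψ_T`), then the bad `x`-set `X = x(t_c⁻¹(B″))` is cut out by some `g ∈ ℚ[X]`, `g ≠ 0`,
  COPRIME TO `q` — the first conjunct of the `hmech` hypothesis of
  `GenEllConjugatePersistent.vojtaIneq_univ_of_persistent` (abc-iut-w5-d081).

Curve points are pairs `z = (x, r)`, "on the curve" is `r^{2k+1} = x(1−x)`, "non-polar" is
`r ≠ 0 ∧ 1 − 2x ≠ 0`, and `t_c` is written inline (the conventions of `GenEllDeFibres`, abc-iut-w5-d015,
with the family parameter `c` of RULING #6). Theorems only; classical; nothing here bears on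
[IUTchIII] Cor. 3.12.
-/

noncomputable section

open Polynomial

namespace Literature.NumberTheory.DiophantineGeometry.GenEll

namespace ConfigurationProtection

/-! ## Transport of the curve data along `ℚ`-algebra homomorphisms -/

section Transport

variable {F F' : Type*} [Field F] [Field F'] [Algebra ℚ F] [Algebra ℚ F']

/-- `t_c` commutes with `ℚ`-algebra homomorphisms of fields. [cite: MochizukiGenEll2010, Thm 2.1 p.12] -/
theorem map_tval (φ : F →ₐ[ℚ] F') (k : ℕ) (c : ℚ) (z : F × F) :
    φ (((1 - 2 * z.1) + algebraMap ℚ F c * z.2 ^ (k + 2)) / (z.2 * (1 - 2 * z.1))) =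
      ((1 - 2 * φ z.1) + algebraMap ℚ F' c * (φ z.2) ^ (k + 2)) / (φ z.2 * (1 - 2 * φ z.1)) := by
  simp [map_div₀, map_sub, map_add, map_mul, map_pow, map_ofNat]

/-- The curve equation is preserved by `ℚ`-algebra homomorphisms. [cite: MochizukiGenEll2010, Thm 2.1 p.12] -/
theorem map_onCurve (φ : F →ₐ[ℚ] F') (k : ℕ) {z : F × F}
    (hz : z.2 ^ (2 * k + 1) = z.1 * (1 - z.1)) :
    (φ z.2) ^ (2 * k + 1) = φ z.1 * (1 - φ z.1) := by
  have := congrArg φ hz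
  simpa [map_pow, map_mul, map_sub] using this

/-- Non-polarity is preserved by (injective) `ℚ`-algebra homomorphisms of fields.
[cite: MochizukiGenEll2010, Thm 2.1 p.12] -/
theorem map_nonpole (φ : F →ₐ[ℚ] F') {z : F × F} (hr : z.2 ≠ 0) (hs : 1 - 2 * z.1 ≠ 0) :
    φ z.2 ≠ 0 ∧ 1 - 2 * φ z.1 ≠ 0 := by
  refine ⟨(map_ne_zero φ).mpr hr, ?_⟩
  have h : φ (1 - 2 * z.1) ≠ 0 := (map_ne_zero φ).mpr hs
  simpa [map_sub, map_mul, map_ofNat] using h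

/-- Roots of a rational polynomial are preserved by `ℚ`-algebra homomorphisms.
[cite: MochizukiGenEll2010, Thm 2.1 p.12] -/
theorem map_aeval_eq_zero (φ : F →ₐ[ℚ] F') {q : ℚ[X]} {a : F} (ha : aeval a q = 0) :
    aeval (φ a) q = 0 := by
  rw [aeval_algHom_apply, ha, map_zero]

end Transport

/-! ## The pole polynomial `c_T` over an algebraic closure of `ℚ` -/

section PolePoly

variable {L : Type*} [Field L] [Algebra ℚ L]

/-- The curve points over the roots of a nonzero `q ∈ ℚ[X]` form a finite set (finitely many
`x`-values, and over each at most `2k+1` values of `r`). [cite: MochizukiGenEll2010, Thm 2.1 p.12] -/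
theorem finite_pointsOver (k : ℕ) {q : ℚ[X]} (hq : q ≠ 0) :
    Set.Finite {z : L × L | aeval z.1 q = 0 ∧ z.2 ^ (2 * k + 1) = z.1 * (1 - z.1)} := by
  classical
  have hsub : {z : L × L | aeval z.1 q = 0 ∧ z.2 ^ (2 * k + 1) = z.1 * (1 - z.1)} ⊆
      ⋃ a ∈ ((q.aroots L).toFinset : Set L),
        (fun r => (a, r)) '' {r : L | (X ^ (2 * k + 1) - C (a * (1 - a))).IsRoot r} := by
    rintro ⟨a, r⟩ ⟨hqa, hcurve⟩
    refine Set.mem_iUnion₂.mpr ⟨a, ?_, ⟨r, ?_, rfl⟩⟩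
    · simp only [Finset.mem_coe, Multiset.mem_toFinset]
      exact (mem_aroots (p := q)).mpr ⟨hq, hqa⟩
    · simp only [Set.mem_setOf_eq, IsRoot, eval_sub, eval_pow, eval_X, eval_C]
      exact sub_eq_zero.mpr hcurve
  refine Set.Finite.subset ?_ hsub
  refine Set.Finite.biUnion (Finset.finite_toSet _) fun a _ => Set.Finite.image _ ?_
  exact Polynomial.finite_setOf_isRoot (X_pow_sub_C_ne_zero (by omega) _)

variable [IsAlgClosure ℚ L]

/-- **The pole polynomial.** For `q ∈ ℚ[X]`, `q ≠ 0`, there is `c_T ∈ ℚ[X]`, `c_T ≠ 0`, whose roots in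
the algebraic closure `L` of `ℚ` are EXACTLY the values `t_c(z)` at the non-polar points `z` of
`D_e(L)` lying over the roots of `q`: (a) every such value is a root; (b) every root is such a value
(roots of the minimal polynomials are Galois conjugates, and Galois permutes the points over the roots
of the rational `q`). In particular the pole set `T` of `ψ_T = u + c_T′/c_T` is finite and
Galois-stable. [cite: MochizukiGenEll2010, Thm 2.1 p.12] -/
theorem exists_polePoly (k : ℕ) (c : ℚ) {q : ℚ[X]} (hq : q ≠ 0) :
    ∃ cT : ℚ[X], cT ≠ 0 ∧
      (∀ z : L × L, z.2 ^ (2 * k + 1) = z.1 * (1 - z.1) → z.2 ≠ 0 → 1 - 2 * z.1 ≠ 0 →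
        aeval z.1 q = 0 →
          aeval (((1 - 2 * z.1) + algebraMap ℚ L c * z.2 ^ (k + 2)) / (z.2 * (1 - 2 * z.1))) cT = 0) ∧
      (∀ τ : L, aeval τ cT = 0 → ∃ z : L × L, z.2 ^ (2 * k + 1) = z.1 * (1 - z.1) ∧ z.2 ≠ 0 ∧
        1 - 2 * z.1 ≠ 0 ∧ aeval z.1 q = 0 ∧
          ((1 - 2 * z.1) + algebraMap ℚ L c * z.2 ^ (k + 2)) / (z.2 * (1 - 2 * z.1)) = τ) := by
  classical
  -- the finite set of NON-POLAR curve points over the roots of `q`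
  have hfin : Set.Finite {z : L × L | aeval z.1 q = 0 ∧ z.2 ^ (2 * k + 1) = z.1 * (1 - z.1) ∧
      z.2 ≠ 0 ∧ 1 - 2 * z.1 ≠ 0} :=
    (finite_pointsOver (L := L) k hq).subset fun z hz => ⟨hz.1, hz.2.1⟩
  set S : Finset (L × L) := hfin.toFinset with hSdef
  -- the value of `t_c` at a point, as a function
  let tv : L × L → L := fun z =>
    ((1 - 2 * z.1) + algebraMap ℚ L c * z.2 ^ (k + 2)) / (z.2 * (1 - 2 * z.1))
  have hint : ∀ x : L, IsIntegral ℚ x := fun x => Algebra.IsIntegral.isIntegral x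
  refine ⟨∏ z ∈ S, minpoly ℚ (tv z), ?_, ?_, ?_⟩
  · exact Finset.prod_ne_zero_iff.mpr fun z _ => minpoly.ne_zero (hint _)
  · intro z hz hr hs hqz
    have hzS : z ∈ S := by
      rw [hSdef, Set.Finite.mem_toFinset]
      exact ⟨hqz, hz, hr, hs⟩
    rw [map_prod]
    exact Finset.prod_eq_zero hzS (minpoly.aeval ℚ (tv z))
  · intro τ hτ
    rw [map_prod, Finset.prod_eq_zero_iff] at hτ
    obtain ⟨z, hzS, hz0⟩ := hτ
    rw [hSdef, Set.Finite.mem_toFinset] at hzS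
    obtain ⟨hqz, hcurve, hr, hs⟩ := hzS
    -- `τ` is a Galois conjugate of `t_c(z)`: `σ τ = t_c z` for some `σ ∈ Gal(L/ℚ)`
    have hconj : IsConjRoot ℚ (tv z) τ := isConjRoot_of_aeval_eq_zero (hint _) hz0
    obtain ⟨σ, hσ⟩ := isConjRoot_iff_exists_algEquiv.mp hconj
    -- the conjugate point `σ⁻¹ z` lies over a root of `q`, is non-polar, and `t_c(σ⁻¹ z) = τ`
    let ρ : L →ₐ[ℚ] L := (σ.symm : L ≃ₐ[ℚ] L).toAlgHom
    have hρτ : ρ (tv z) = τ := by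
      change σ.symm (tv z) = τ
      rw [← hσ, AlgEquiv.symm_apply_apply]
    refine ⟨(ρ z.1, ρ z.2), map_onCurve ρ k hcurve, (map_nonpole ρ hr hs).1,
      (map_nonpole ρ hr hs).2, map_aeval_eq_zero ρ hqz, ?_⟩
    rw [← hρτ]
    exact (map_tval ρ k c z).symm

omit [IsAlgClosure ℚ L] in
/-- **No root of the pole polynomial is a critical value.** Let `Pers ∈ ℚ[X]` vanish at the
`x`-coordinate of every non-polar curve point whose `t_c`-value lies in the set `CV` of "forbidden
values" (the critical values of `t_c`: `Pers` = the persistent polynomial of `X_crit(t_c)`), and let the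
configuration polynomial `q` be COPRIME to `Pers` (no entry in `X_crit(t_c)`). Then a polynomial `c_T`
all of whose roots are `t_c`-values over the roots of `q` (property (b) of `exists_polePoly`) has no root
in `CV` — so `ψ_T = u + c_T′/c_T` has no pole at a critical value and `β_T ∘ ψ_T ∘ t_c` is Belyi.
[cite: MochizukiGenEll2010, Thm 2.1 p.12] -/
theorem polePoly_root_not_mem (k : ℕ) (c : ℚ) {q Pers cT : ℚ[X]} (hcop : IsCoprime q Pers)
    (CV : Set L)
    (hCV : ∀ z : L × L, z.2 ^ (2 * k + 1) = z.1 * (1 - z.1) → z.2 ≠ 0 → 1 - 2 * z.1 ≠ 0 →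
      ((1 - 2 * z.1) + algebraMap ℚ L c * z.2 ^ (k + 2)) / (z.2 * (1 - 2 * z.1)) ∈ CV →
        aeval z.1 Pers = 0)
    (hT : ∀ τ : L, aeval τ cT = 0 → ∃ z : L × L, z.2 ^ (2 * k + 1) = z.1 * (1 - z.1) ∧ z.2 ≠ 0 ∧
      1 - 2 * z.1 ≠ 0 ∧ aeval z.1 q = 0 ∧
        ((1 - 2 * z.1) + algebraMap ℚ L c * z.2 ^ (k + 2)) / (z.2 * (1 - 2 * z.1)) = τ) :
    ∀ τ : L, aeval τ cT = 0 → τ ∉ CV := by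
  intro τ hτ hτCV
  obtain ⟨z, hcurve, hr, hs, hqz, htz⟩ := hT τ hτ
  have hPz : aeval z.1 Pers = 0 := hCV z hcurve hr hs (htz ▸ hτCV)
  obtain ⟨a, b, hab⟩ := hcop
  have := congrArg (aeval z.1) hab
  rw [map_add, map_mul, map_mul, hqz, hPz, mul_zero, mul_zero, add_zero, map_one] at this
  exact zero_ne_one this

end PolePoly

/-! ## Exact avoidance: the bad `x`-set is coprime to the configuration -/

section Avoidance

variable {L : Type*} [Field L] [Algebra ℚ L] [Algebra.IsAlgebraic ℚ L]

/-- **Exact avoidance.** Let `B″ ⊂ L` be a finite set of `u`-values containing NO `t_c`-value of a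
non-polar curve point over a root of `q` (the finite bad values `ψ_T⁻¹(β_T⁻¹{0,1,∞})` of the protected
mechanism: those `t_c`-values are poles of `ψ_T`, sent to `∞ ∉ β_T⁻¹{0,1,∞}`), and let `X ⊂ L` be a
finite set of `x`-coordinates of non-polar curve points with `t_c`-value in `B″` (the bad `x`-set
`x(t_c⁻¹(B″))` of the mechanism, or any subset of it). Then some `g ∈ ℚ[X]`, `g ≠ 0`, vanishes on `X`
and is COPRIME to `q` (`g :=` the product of the minimal polynomials of the elements of `X`): no entry
of the configuration is bad. This is the first conjunct of the hypothesis `hmech` of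
`vojtaIneq_univ_of_persistent`. [cite: MochizukiGenEll2010, Thm 2.1 p.12] -/
theorem exists_badPoly_isCoprime (k : ℕ) (c : ℚ) (q : ℚ[X]) (Bvals : Finset L)
    (hT : ∀ z : L × L, z.2 ^ (2 * k + 1) = z.1 * (1 - z.1) → z.2 ≠ 0 → 1 - 2 * z.1 ≠ 0 →
      aeval z.1 q = 0 →
        ((1 - 2 * z.1) + algebraMap ℚ L c * z.2 ^ (k + 2)) / (z.2 * (1 - 2 * z.1)) ∉ Bvals)
    (X : Finset L)
    (hX : ∀ a ∈ X, ∃ r : L, r ^ (2 * k + 1) = a * (1 - a) ∧ r ≠ 0 ∧ 1 - 2 * a ≠ 0 ∧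
      ((1 - 2 * a) + algebraMap ℚ L c * r ^ (k + 2)) / (r * (1 - 2 * a)) ∈ Bvals) :
    ∃ g : ℚ[X], g ≠ 0 ∧ IsCoprime g q ∧ ∀ a ∈ X, aeval a g = 0 := by
  classical
  have hint : ∀ x : L, IsIntegral ℚ x := fun x => Algebra.IsIntegral.isIntegral x
  refine ⟨∏ a ∈ X, minpoly ℚ a, ?_, ?_, ?_⟩
  · exact Finset.prod_ne_zero_iff.mpr fun a _ => minpoly.ne_zero (hint _)
  · refine IsCoprime.prod_left fun a ha => ?_
    -- `minpoly ℚ a` is irreducible; it is coprime to `q` unless it divides `q`, i.e. unless `q(a) = 0`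
    refine ((minpoly.irreducible (hint a)).coprime_iff_not_dvd).mpr fun hdvd => ?_
    have hqa : aeval a q = 0 := by
      obtain ⟨m, hm⟩ := hdvd
      rw [hm, map_mul, minpoly.aeval, zero_mul]
    obtain ⟨r, hcurve, hr, hs, hB⟩ := hX a ha
    exact hT (a, r) hcurve hr hs hqa hB
  · intro a ha
    rw [map_prod]
    exact Finset.prod_eq_zero ha (minpoly.aeval ℚ a)

end Avoidance

/-! ## Transport to the points over an arbitrary field (`ℂ`, `Q̄₂`) -/

section AnyField

variable {L : Type*} [Field L] [Algebra ℚ L] [IsAlgClosed L]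
variable {F : Type*} [Field F] [Algebra ℚ F]

/-- **Transport to any field.** A polynomial identity in the `t_c`-value that holds at every non-polar
point of `D_e(L)` over the roots of `q ≠ 0`, `L` an algebraically closed field over `ℚ`, holds at every
such point over ANY field `F` of characteristic `0` (`ℂ`, `Q̄₂`): the coordinates of such a point are
algebraic, so `ℚ(x, r) ⊆ F` embeds into `L`. (Use with `P := c_T` from `exists_polePoly`: every point of
`D_e(ℂ)` or `D_e(Q̄₂)` over an algebraic entry of the configuration has `t_c`-value a root of `c_T`,
i.e. is sent to `∞` by `ψ_T`.) [cite: MochizukiGenEll2010, Thm 2.1 p.12] -/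
theorem aeval_eq_zero_of_point (k : ℕ) (c : ℚ) {q : ℚ[X]} (hq : q ≠ 0) (P : ℚ[X])
    (hL : ∀ z : L × L, z.2 ^ (2 * k + 1) = z.1 * (1 - z.1) → z.2 ≠ 0 → 1 - 2 * z.1 ≠ 0 →
      aeval z.1 q = 0 →
        aeval (((1 - 2 * z.1) + algebraMap ℚ L c * z.2 ^ (k + 2)) / (z.2 * (1 - 2 * z.1))) P = 0)
    (w : F × F) (hw : w.2 ^ (2 * k + 1) = w.1 * (1 - w.1)) (hr : w.2 ≠ 0) (hs : 1 - 2 * w.1 ≠ 0)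
    (hqw : aeval w.1 q = 0) :
    aeval (((1 - 2 * w.1) + algebraMap ℚ F c * w.2 ^ (k + 2)) / (w.2 * (1 - 2 * w.1))) P = 0 := by
  classical
  -- both coordinates are algebraic over `ℚ`
  have h1a : IsAlgebraic ℚ w.1 := ⟨q, hq, hqw⟩
  have h2a : IsAlgebraic ℚ w.2 := by
    refine IsAlgebraic.of_pow (by omega : 0 < 2 * k + 1) ?_
    rw [hw]
    exact h1a.mul ((isAlgebraic_one).sub h1a)
  have h1 : IsIntegral ℚ w.1 := h1a.isIntegral
  have h2 : IsIntegral ℚ w.2 := h2a.isIntegral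
  -- the field `ℚ(x, r) ⊆ F`, finite-dimensional, embeds into `L`
  let K₀ : IntermediateField ℚ F := IntermediateField.adjoin ℚ {w.1, w.2}
  haveI : FiniteDimensional ℚ K₀ := by
    refine IntermediateField.finiteDimensional_adjoin fun x hx => ?_
    simp only [Set.mem_insert_iff, Set.mem_singleton_iff] at hx
    rcases hx with rfl | rfl
    · exact h1
    · exact h2
  let ι : K₀ →ₐ[ℚ] L := IsAlgClosed.lift
  have hw1 : w.1 ∈ K₀ := IntermediateField.subset_adjoin ℚ _ (by simp)
  have hw2 : w.2 ∈ K₀ := IntermediateField.subset_adjoin ℚ _ (by simp)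
  -- the point `u = w` read in `K₀`
  obtain ⟨u, hu1, hu2⟩ : ∃ u : K₀ × K₀, (u.1 : F) = w.1 ∧ (u.2 : F) = w.2 :=
    ⟨(⟨w.1, hw1⟩, ⟨w.2, hw2⟩), rfl, rfl⟩
  have hval : ∀ x : K₀, K₀.val x = (x : F) := fun x => rfl
  have hvinj : Function.Injective K₀.val := (K₀.val : K₀ →+* F).injective
  have hu_curve : u.2 ^ (2 * k + 1) = u.1 * (1 - u.1) := by
    apply hvinj
    rw [map_pow, map_mul, map_sub, map_one, hval, hval, hu1, hu2]
    exact hw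
  have hu_r : u.2 ≠ 0 := by
    intro h
    apply hr
    rw [← hu2, h, ZeroMemClass.coe_zero]
  have hu_s : 1 - 2 * u.1 ≠ 0 := by
    intro h
    apply hs
    have := congrArg K₀.val h
    rw [map_sub, map_one, map_mul, map_ofNat, hval, hu1, map_zero] at this
    exact this
  have hu_q : aeval u.1 q = 0 := by
    apply hvinj
    rw [← aeval_algHom_apply, hval, hu1, map_zero]
    exact hqw
  -- apply the hypothesis at the image point in `L`
  have hz := hL (ι u.1, ι u.2) (map_onCurve ι k hu_curve) (map_nonpole ι hu_r hu_s).1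
    (map_nonpole ι hu_r hu_s).2 (map_aeval_eq_zero ι hu_q)
  have htv : (((1 - 2 * ι u.1) + algebraMap ℚ L c * (ι u.2) ^ (k + 2)) / (ι u.2 * (1 - 2 * ι u.1))) =
      ι (((1 - 2 * u.1) + algebraMap ℚ K₀ c * u.2 ^ (k + 2)) / (u.2 * (1 - 2 * u.1))) :=
    (map_tval ι k c u).symm
  have hz' : aeval (((1 - 2 * u.1) + algebraMap ℚ K₀ c * u.2 ^ (k + 2)) / (u.2 * (1 - 2 * u.1))) P
      = 0 := by
    have hιinj : Function.Injective ι := (ι : K₀ →+* L).injective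
    apply hιinj
    rw [← aeval_algHom_apply, map_zero, ← htv]
    exact hz
  -- read back in `F`
  have := congrArg K₀.val hz'
  rw [← aeval_algHom_apply, map_zero, map_tval K₀.val k c u, hval, hval, hu1, hu2] at this
  exact this

/-- **The pole polynomial, field-agnostic form.** For `q ≠ 0` there is `c_T ∈ ℚ[X]`, `c_T ≠ 0`, such
that (a) at every non-polar point of `D_e(F)` over a root of `q` — `F` ANY field over `ℚ`, e.g. `ℂ` or
`Q̄₂` — the `t_c`-value is a root of `c_T` (these points are poles of `ψ_T`, hence protected), and
(b) every root of `c_T` in the algebraic closure `L` is such a `t_c`-value (so, with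
`polePoly_root_not_mem`, `c_T` has no critical value of `t_c` among its roots when `q` is coprime to the
persistent polynomial). [cite: MochizukiGenEll2010, Thm 2.1 p.12] -/
theorem exists_polePoly_anyField (L : Type*) [Field L] [Algebra ℚ L] [IsAlgClosure ℚ L]
    (F : Type*) [Field F] [Algebra ℚ F] (k : ℕ) (c : ℚ) {q : ℚ[X]} (hq : q ≠ 0) :
    ∃ cT : ℚ[X], cT ≠ 0 ∧
      (∀ w : F × F, w.2 ^ (2 * k + 1) = w.1 * (1 - w.1) → w.2 ≠ 0 → 1 - 2 * w.1 ≠ 0 →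
        aeval w.1 q = 0 →
          aeval (((1 - 2 * w.1) + algebraMap ℚ F c * w.2 ^ (k + 2)) / (w.2 * (1 - 2 * w.1))) cT = 0) ∧
      (∀ τ : L, aeval τ cT = 0 → ∃ z : L × L, z.2 ^ (2 * k + 1) = z.1 * (1 - z.1) ∧ z.2 ≠ 0 ∧
        1 - 2 * z.1 ≠ 0 ∧ aeval z.1 q = 0 ∧
          ((1 - 2 * z.1) + algebraMap ℚ L c * z.2 ^ (k + 2)) / (z.2 * (1 - 2 * z.1)) = τ) := by
  haveI : IsAlgClosed L := IsAlgClosure.isAlgClosed ℚ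
  obtain ⟨cT, hne, ha, hb⟩ := exists_polePoly (L := L) k c hq
  exact ⟨cT, hne, fun w hw hr hs hqw => aeval_eq_zero_of_point k c hq cT ha w hw hr hs hqw, hb⟩

end AnyField

end ConfigurationProtection

end Literature.NumberTheory.DiophantineGeometry.GenEll

end
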